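import Summits.CriticalPhenomena.PercolationContinuityZ3.Theorems.PercExchangeRateTransportTransportLemmaFence

/-!
# Transport lemma of route `PercExchangeRateTransport` — registered stub `stub_upperFence` (positivity propagation)

Crux `Summit.CriticalPhenomena.PercolationContinuityZ3.Theses.PercExchangeRateTransport.TransportLemma`
(stmt-CriticalPhenomena-16063), line `corrector` (tree `Cruxes/TransportLemma/Lines/corrector.lean` rev 2,
strategist planner-cstrat-stmt-CriticalPhenomena-16063-b1-0; landed by the line lead).

Statement (registered stub, verbatim): uniformly in `t₀ ∈ [lo,hi]`,
`pc s − pc t₀ + a(pc t₀,t₀)(s − t₀) ≤ η|s − t₀|` for `|s − t₀| ≤ τ(η)` — the UPPER one-sided cone bound on the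
threshold curve. Proof: straight segments issued from `(pc t₀ + ε, t₀)` with slope `−(a₀ ∓ η)` (forward /
backward in time) are monotone for every `Θ n`, `n ≥ m(η/2)` (fence lemma + the handed-in uniform modulus of `a`);
the threshold property turns `Θ∞ > 0` at their far end into `pc s ≤ γ s`; then `ε ↓ 0`. The bound `A` and the
uniform moduli of `a` and `pc` are HYPOTHESES here (discharged by `collar_moduli`, `pc_modulus` at assembly).
-/

namespace Summit.CriticalPhenomena.PercolationContinuityZ3.Theorems.TransportLemma

open Filter Topology Set

/-- **stub_upperFence — upper fence (positivity propagation)**, registered stub of line `corrector`, verbatim.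
For every `η > 0` there is `τ > 0` such that, uniformly in `t₀ ∈ [lo,hi]` and `s ∈ [lo,hi]` with `|s − t₀| ≤ τ`,
`pc s − pc t₀ + a (pc t₀) t₀ * (s − t₀) ≤ η * |s − t₀|`. The bound `A` on `a`, a uniform modulus of `a` on the
two-sided closed collar and a uniform modulus of `pc` are hypotheses. Proof: a straight segment issued from
`(pc t₀ + ε, t₀)` with slope `−(a(pc t₀,t₀) − η)` forward in time (resp. `−(a(pc t₀,t₀) + η)` backward) is
monotone (resp. antitone) for every `Θ n`, `n ≥ m(η/2)`, by the fence lemma; `Θ∞ > 0` at `(pc t₀ + ε, t₀)`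
propagates to its far end, which the threshold property places at or above `pc s`; then `ε ↓ 0`. -/
theorem stub_upperFence :
    ∀ (Θ : ℕ → ℝ → ℝ → ℝ) (pc : ℝ → ℝ) (a : ℝ → ℝ → ℝ) (lo hi ρ A : ℝ),
      0 < lo → lo < hi → hi < 1 → 0 < ρ →
      (∀ n, ContDiffOn ℝ 1 (fun x : ℝ × ℝ => Θ n x.1 x.2) (Set.Ioo 0 1 ×ˢ Set.Ioo 0 1)) →
      (∀ n t, Monotone (fun p => Θ n p t)) →
      (∀ p t, Antitone (fun n => Θ n p t)) →
      (∀ n p t, 0 ≤ Θ n p t) →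
      (∀ t ∈ Set.Icc lo hi, ρ < pc t ∧ pc t + ρ < 1) →
      (∀ t ∈ Set.Icc lo hi, ∀ p : ℝ,
          (p < pc t → (⨅ n, Θ n p t) = 0) ∧ (pc t < p → 0 < ⨅ n, Θ n p t)) →
      (∀ t ∈ Set.Icc lo hi, ∀ p : ℝ, |p - pc t| ≤ ρ → |a p t| ≤ A) →
      (∀ η > (0 : ℝ), ∃ ω > (0 : ℝ), ∀ t ∈ Set.Icc lo hi, ∀ t' ∈ Set.Icc lo hi, ∀ p p' : ℝ,
          |p - pc t| ≤ ρ → |p' - pc t'| ≤ ρ → |t - t'| ≤ ω → |p - p'| ≤ ω →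
          |a p t - a p' t'| ≤ η) →
      (∀ κ > (0 : ℝ), ∃ τ > (0 : ℝ), ∀ t ∈ Set.Icc lo hi, ∀ t' ∈ Set.Icc lo hi,
          |t - t'| ≤ τ → |pc t - pc t'| ≤ κ) →
      (∀ η > (0 : ℝ), ∃ δ > (0 : ℝ), ∃ m : ℕ, ∀ n ≥ m, ∀ t ∈ Set.Icc lo hi, ∀ p : ℝ,
          pc t - δ ≤ p → p ≤ pc t + ρ →
          |deriv (fun s => Θ n p s) t - a p t * deriv (fun q => Θ n q t) p|
            ≤ η * deriv (fun q => Θ n q t) p) →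
      ∀ η > (0 : ℝ), ∃ τ > (0 : ℝ), ∀ t₀ ∈ Set.Icc lo hi, ∀ s ∈ Set.Icc lo hi, |s - t₀| ≤ τ →
        pc s - pc t₀ + a (pc t₀) t₀ * (s - t₀) ≤ η * |s - t₀| := by
  intro Θ pc a lo hi ρ A hlo hlohi hhi hρ hC1 hmp hanti hnn hcollar hthr hA hω hτ hex η hη
  -- constants of the construction
  have hη2 : (0:ℝ) < η / 2 := by positivity
  obtain ⟨δ, hδ, m, hm⟩ := hex (η / 2) hη2
  obtain ⟨ω, hω0, hωa⟩ := hω (η / 2) hη2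
  have hκ : 0 < min δ ρ := lt_min hδ hρ
  obtain ⟨τ₁, hτ₁, hpc1⟩ := hτ (min δ ρ / 4) (by positivity)
  have hA0 : 0 ≤ A :=
    le_trans (abs_nonneg _) (hA lo ⟨le_rfl, hlohi.le⟩ (pc lo) (by simp [hρ.le]))
  obtain ⟨θ, hθ0, hθω, hθκ⟩ : ∃ θ : ℝ, 0 < θ ∧ θ ≤ ω ∧ θ ≤ min δ ρ / 4 :=
    ⟨min ω (min δ ρ / 4), lt_min hω0 (by positivity), min_le_left _ _, min_le_right _ _⟩
  obtain ⟨B, hB0, hBA⟩ : ∃ B : ℝ, 0 < B ∧ A + η ≤ B := ⟨A + η + 1, by positivity, by linarith⟩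
  obtain ⟨τ, hτ0, hττ₁, hτω, hτB⟩ : ∃ τ : ℝ, 0 < τ ∧ τ ≤ τ₁ ∧ τ ≤ ω ∧ B * τ ≤ θ / 2 := by
    refine ⟨min τ₁ (min ω (θ / (2 * B))), lt_min hτ₁ (lt_min hω0 (by positivity)),
      min_le_left _ _, le_trans (min_le_right _ _) (min_le_left _ _), ?_⟩
    have h1 : min τ₁ (min ω (θ / (2 * B))) ≤ θ / (2 * B) :=
      le_trans (min_le_right _ _) (min_le_right _ _)
    calc B * min τ₁ (min ω (θ / (2 * B))) ≤ B * (θ / (2 * B)) :=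
          mul_le_mul_of_nonneg_left h1 hB0.le
      _ = θ / 2 := by field_simp
  refine ⟨τ, hτ0, ?_⟩
  intro t₀ ht₀ s hs hst
  -- generic tools
  have bdd : ∀ q r, BddBelow (Set.range fun n => Θ n q r) := fun q r =>
    ⟨0, by rintro _ ⟨n, rfl⟩; exact hnn n q r⟩
  have infle : ∀ q r q' r', (∀ n ≥ m, Θ n q r ≤ Θ n q' r') →
      (⨅ n, Θ n q r) ≤ ⨅ n, Θ n q' r' := by
    intro q r q' r' h
    refine le_ciInf fun N => ?_
    calc (⨅ n, Θ n q r) ≤ Θ (max N m) q r := ciInf_le (bdd q r) _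
      _ ≤ Θ (max N m) q' r' := h _ (le_max_right _ _)
      _ ≤ Θ N q' r' := hanti q' r' (le_max_left _ _)
  have hsq : IsOpen (Set.Ioo (0:ℝ) 1 ×ˢ Set.Ioo (0:ℝ) 1) := isOpen_Ioo.prod isOpen_Ioo
  have ha₀ : |a (pc t₀) t₀| ≤ A := hA t₀ ht₀ (pc t₀) (by simp [hρ.le])
  have hδρ1 : min δ ρ ≤ δ := min_le_left _ _
  have hδρ2 : min δ ρ ≤ ρ := min_le_right _ _
  -- facts along a straight segment r ↦ p₀ - c (r - t₀), |p₀ - pc t₀| = ε < θ/2, |c| ≤ B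
  have seg : ∀ (ε c : ℝ), 0 < ε → ε < θ / 2 → |c| ≤ B →
      ∀ r ∈ Set.Icc lo hi, |r - t₀| ≤ τ →
        (pc r - δ ≤ pc t₀ + ε - c * (r - t₀) ∧ pc t₀ + ε - c * (r - t₀) ≤ pc r + ρ) ∧
        (pc t₀ + ε - c * (r - t₀) ∈ Set.Ioo (0:ℝ) 1 ∧ r ∈ Set.Ioo (0:ℝ) 1) ∧
        |a (pc t₀ + ε - c * (r - t₀)) r - a (pc t₀) t₀| ≤ η / 2 := by
    intro ε c hε hεθ hcB r hr hrt
    have h1 : |pc t₀ + ε - c * (r - t₀) - pc t₀| ≤ θ := by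
      have e : pc t₀ + ε - c * (r - t₀) - pc t₀ = ε - c * (r - t₀) := by ring
      rw [e]
      have hct : |c| * |r - t₀| ≤ B * τ :=
        mul_le_mul hcB hrt (abs_nonneg _) hB0.le
      calc |ε - c * (r - t₀)| ≤ |ε| + |c * (r - t₀)| := abs_sub _ _
        _ = ε + |c| * |r - t₀| := by rw [abs_of_pos hε, abs_mul]
        _ ≤ θ := by linarith
    have h2 : |pc r - pc t₀| ≤ min δ ρ / 4 := hpc1 r hr t₀ ht₀ (hrt.trans hττ₁)
    have h3 : |pc t₀ + ε - c * (r - t₀) - pc r| ≤ min δ ρ / 2 := by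
      have e : pc t₀ + ε - c * (r - t₀) - pc r
          = (pc t₀ + ε - c * (r - t₀) - pc t₀) - (pc r - pc t₀) := by ring
      rw [e]
      calc |(pc t₀ + ε - c * (r - t₀) - pc t₀) - (pc r - pc t₀)|
          ≤ |pc t₀ + ε - c * (r - t₀) - pc t₀| + |pc r - pc t₀| := abs_sub _ _
        _ ≤ θ + min δ ρ / 4 := by linarith
        _ ≤ min δ ρ / 2 := by linarith
    obtain ⟨h3a, h3b⟩ := abs_le.1 h3
    obtain ⟨hc1, hc2⟩ := hcollar r hr
    refine ⟨⟨by linarith, by linarith⟩,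
      ⟨⟨by linarith, by linarith⟩, ⟨by linarith [hr.1], by linarith [hr.2]⟩⟩, ?_⟩
    exact hωa r hr t₀ ht₀ (pc t₀ + ε - c * (r - t₀)) (pc t₀)
      (by rw [abs_le]; constructor <;> linarith) (by simp [hρ.le]) (le_trans hrt hτω)
      (le_trans h1 hθω)
  -- the claim at every small ε > 0
  have claim : ∀ ε : ℝ, 0 < ε → ε < θ / 2 →
      pc s - pc t₀ + a (pc t₀) t₀ * (s - t₀) ≤ η * |s - t₀| + ε := by
    intro ε hε hεθ
    rcases lt_trichotomy t₀ s with hlt | heq | hgt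
    · -- forward segment of slope -(a₀ - η), issued from (pc t₀ + ε, t₀)
      have hcB : |a (pc t₀) t₀ - η| ≤ B := by
        calc |a (pc t₀) t₀ - η| ≤ |a (pc t₀) t₀| + |η| := abs_sub _ _
          _ ≤ B := by rw [abs_of_pos hη]; linarith
      have hIcc : Set.Icc t₀ s ⊆ Set.Icc lo hi := Set.Icc_subset_Icc ht₀.1 hs.2
      have hrt : ∀ r ∈ Set.Icc t₀ s, |r - t₀| ≤ τ := by
        intro r hr
        rw [abs_of_nonneg (by linarith [hr.1])]
        have : |s - t₀| = s - t₀ := abs_of_pos (by linarith)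
        linarith [hr.2]
      have F := fun r (hr : r ∈ Set.Icc t₀ s) =>
        seg ε (a (pc t₀) t₀ - η) hε hεθ hcB r (hIcc hr) (hrt r hr)
      have key : ∀ n ≥ m, Θ n (pc t₀ + ε) t₀
          ≤ Θ n (pc t₀ + ε - (a (pc t₀) t₀ - η) * (s - t₀)) s := by
        intro n hn
        have hM : MonotoneOn (fun r => Θ n (pc t₀ + ε - (a (pc t₀) t₀ - η) * (r - t₀)) r)
            (Set.Icc t₀ s) :=
          fence_monotoneOn (Θ n) a (fun r => pc t₀ + ε - (a (pc t₀) t₀ - η) * (r - t₀))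
            (fun _ => -(a (pc t₀) t₀ - η)) (η / 2) t₀ s
            (fun r hr => ((hC1 n).differentiableOn one_ne_zero).differentiableAt
              (hsq.mem_nhds (F r hr).2.1))
            (hmp n)
            (fun r hr => by
              have h := (((hasDerivAt_id r).sub_const t₀).const_mul
                (a (pc t₀) t₀ - η)).const_sub (pc t₀ + ε)
              simpa using h.hasDerivWithinAt)
            (fun r hr => hm n hn r (hIcc hr) _ (F r hr).1.1 (F r hr).1.2)
            (fun r hr => by
              have h := (abs_le.1 (F r hr).2.2).1
              linarith)
        have h1 := hM (Set.left_mem_Icc.2 hlt.le) (Set.right_mem_Icc.2 hlt.le) hlt.le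
        simpa using h1
      have hpos : 0 < ⨅ n, Θ n (pc t₀ + ε) t₀ := (hthr t₀ ht₀ (pc t₀ + ε)).2 (by linarith)
      have hpos' : 0 < ⨅ n, Θ n (pc t₀ + ε - (a (pc t₀) t₀ - η) * (s - t₀)) s :=
        lt_of_lt_of_le hpos (infle _ _ _ _ key)
      have hge : pc s ≤ pc t₀ + ε - (a (pc t₀) t₀ - η) * (s - t₀) := by
        by_contra hcon
        push Not at hcon
        have h0 := (hthr s hs _).1 hcon
        linarith
      have e3 : (a (pc t₀) t₀ - η) * (s - t₀) = a (pc t₀) t₀ * (s - t₀) - η * (s - t₀) := by ring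
      rw [abs_of_pos (show 0 < s - t₀ by linarith)]
      linarith
    · subst heq
      simp
      exact hε.le
    · -- backward segment of slope -(a₀ + η), ending at (pc t₀ + ε, t₀)
      have hcB : |a (pc t₀) t₀ + η| ≤ B := by
        calc |a (pc t₀) t₀ + η| ≤ |a (pc t₀) t₀| + |η| := abs_add_le _ _
          _ ≤ B := by rw [abs_of_pos hη]; linarith
      have hIcc : Set.Icc s t₀ ⊆ Set.Icc lo hi := Set.Icc_subset_Icc hs.1 ht₀.2
      have hrt : ∀ r ∈ Set.Icc s t₀, |r - t₀| ≤ τ := by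
        intro r hr
        rw [abs_of_nonpos (by linarith [hr.2])]
        have : |s - t₀| = -(s - t₀) := abs_of_neg (by linarith)
        linarith [hr.1]
      have F := fun r (hr : r ∈ Set.Icc s t₀) =>
        seg ε (a (pc t₀) t₀ + η) hε hεθ hcB r (hIcc hr) (hrt r hr)
      have key : ∀ n ≥ m, Θ n (pc t₀ + ε) t₀
          ≤ Θ n (pc t₀ + ε - (a (pc t₀) t₀ + η) * (s - t₀)) s := by
        intro n hn
        have hM : AntitoneOn (fun r => Θ n (pc t₀ + ε - (a (pc t₀) t₀ + η) * (r - t₀)) r)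
            (Set.Icc s t₀) :=
          fence_antitoneOn (Θ n) a (fun r => pc t₀ + ε - (a (pc t₀) t₀ + η) * (r - t₀))
            (fun _ => -(a (pc t₀) t₀ + η)) (η / 2) s t₀
            (fun r hr => ((hC1 n).differentiableOn one_ne_zero).differentiableAt
              (hsq.mem_nhds (F r hr).2.1))
            (hmp n)
            (fun r hr => by
              have h := (((hasDerivAt_id r).sub_const t₀).const_mul
                (a (pc t₀) t₀ + η)).const_sub (pc t₀ + ε)
              simpa using h.hasDerivWithinAt)
            (fun r hr => hm n hn r (hIcc hr) _ (F r hr).1.1 (F r hr).1.2)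
            (fun r hr => by
              have h := (abs_le.1 (F r hr).2.2).2
              linarith)
        have h1 := hM (Set.left_mem_Icc.2 hgt.le) (Set.right_mem_Icc.2 hgt.le) hgt.le
        simpa using h1
      have hpos : 0 < ⨅ n, Θ n (pc t₀ + ε) t₀ := (hthr t₀ ht₀ (pc t₀ + ε)).2 (by linarith)
      have hpos' : 0 < ⨅ n, Θ n (pc t₀ + ε - (a (pc t₀) t₀ + η) * (s - t₀)) s :=
        lt_of_lt_of_le hpos (infle _ _ _ _ key)
      have hge : pc s ≤ pc t₀ + ε - (a (pc t₀) t₀ + η) * (s - t₀) := by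
        by_contra hcon
        push Not at hcon
        have h0 := (hthr s hs _).1 hcon
        linarith
      have e3 : (a (pc t₀) t₀ + η) * (s - t₀) = a (pc t₀) t₀ * (s - t₀) + η * (s - t₀) := by ring
      rw [abs_of_neg (show s - t₀ < 0 by linarith)]
      have e4 : η * -(s - t₀) = -(η * (s - t₀)) := by ring
      linarith
  -- ε ↓ 0
  apply le_of_forall_pos_le_add
  intro ε hε
  have h := claim (min ε (θ / 4)) (lt_min hε (by positivity))
    (lt_of_le_of_lt (min_le_right _ _) (by linarith))
  linarith [min_le_left ε (θ / 4)]

end Summit.CriticalPhenomena.PercolationContinuityZ3.Theorems.TransportLemma
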